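import Summits.NavierStokesRegularity.NavierStokesRegularity.Theorems.TypeIliouvilleNoTypeII.Negative.WithoutLerayHopfFalse

/-!
# `TypeIliouvilleNoTypeII` (stmt-NavierStokesRegularity-0056): the energy class is load-bearing for EVERY clause

Negative (support) lemmas for the §B programme «Type-II-exclusion estimates» (D-0081), whose candidates
are clauses `D ν T u p` asserted either of every maximal classical BLOW-UP from a rapidly decaying datum
(blow-up form) or of every classical solution in that frame (a-priori form), and reduced to the crux
by the door calculus `Theorems/TypeILiouvilleTypeIliouvilleNoTypeIIDoorCalculus.lean`.  This file records,
once and schematically, what the Koch–Nadirashvili–Seregin–Šverák parasitic drift `u = g(t)·e₁`,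
`p = −g′(t) x₁` (Acta Math. 203 (2009), §1 p. 3) does to such clauses when the Leray–Hopf (finite
energy) hypothesis is deleted from the frame:

* `blowupClause_false_without_lerayHopf_of_drift` — TEMPLATE (blow-up form): if the conclusion `D` fails on
  ONE admissible blowing-up drift (`g` smooth on `(-∞,1)`, `g 0 = 0`, `|g| → ∞` at `1`), the clause with
  `IsLerayHopfOn` deleted is false.  The instance `D := IsTypeIBlowup` is the landed
  `typeIliouvilleNoTypeII_false_without_lerayHopf` (sibling file).
* `aprioriClause_false_without_lerayHopf_of_drift` — TEMPLATE (a-priori form): if `D` fails on ONE drift with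
  `g` smooth on `(-∞,1)` and `g 0 = 0` (no blow-up needed), the a-priori clause with `IsLerayHopfOn`
  deleted is false.
* `zeroDatumStaysZero_false_without_lerayHopf` — the sharpest instance: WITHOUT the energy class the frame
  does not even determine the solution from its datum — the drift `g(t) = t` is a classical solution on
  `[0,1) × ℝ³` from the datum `0` which is non-zero at every `t ∈ (0,1)`.  Hence every a-priori bound of a
  solution in terms of its datum (the shape of every «controlling quantity» estimate) must use the energy
  class.
* `gradientBlowupClause_false_without_lerayHopf` — WITHOUT the energy class even the Beale–Kato–Majda-type
  NECESSARY condition for blow-up fails in this frame: the Type-II drift `g(t) = (1−t)⁻¹ − 1` is a maximal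
  classical solution from the datum `0` (no classical extension past `1`) all of whose spatial derivatives
  vanish identically (`fderiv_drift_eq_zero`) — so no clause concluding growth of `∇u` / `ω` / the strain
  near the blow-up time survives the deletion of `IsLerayHopfOn`.

WHAT THIS IS NOT: not NS regularity or blow-up; frame-calibration facts for critics and planners (which
hypothesis of the crux frame a candidate's proof must consume).
[cite: KochNadirashviliSereginSverak2009, §1 p. 3 (parasitic solutions)]
-/

noncomputable section
-- the summit and its single sub-problem share the name (CONVENTIONS §1), as in every Theorems file
set_option linter.dupNamespace false

namespace Summit.NavierStokesRegularity.NavierStokesRegularity.Theorems.TypeIliouvilleNoTypeIINegative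

open Set Filter Topology Function
open scoped ContDiff
open Literature.Analysis.FluidPDE
open Summit.NavierStokesRegularity.NavierStokesRegularity.Theorems.RungReynoldsOneNegative

variable {D : ℝ → ℝ → (ℝ → EuclideanSpace ℝ (Fin 3) → EuclideanSpace ℝ (Fin 3)) → (ℝ → EuclideanSpace ℝ (Fin 3) → ℝ) → Prop}

/-! ## Templates -/

/-- **Template (blow-up form).**  A clause over maximal classical solutions from rapidly decaying data,
with the Leray–Hopf hypothesis deleted, is false as soon as its conclusion fails on one blowing-up
parasitic drift (`g` smooth on `(-∞, 1)`, `g(0) = 0`, `|g(t)| → ∞` as `t ↑ 1`), at any viscosity.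
[cite: KochNadirashviliSereginSverak2009, §1 p. 3 (parasitic solutions)] -/
theorem blowupClause_false_without_lerayHopf_of_drift {g : ℝ → ℝ} (hg : ContDiffOn ℝ ∞ g (Iio 1))
    (h0 : g 0 = 0) (hlim : Tendsto (fun t => |g t|) (𝓝[<] (1 : ℝ)) atTop) {ν : ℝ} (hν : 0 < ν)
    (hD : ¬ D ν 1 (drift g) (driftP g)) :
    ¬ (∀ (ν T : ℝ), 0 < ν → 0 < T → ∀ (u : ℝ → EuclideanSpace ℝ (Fin 3) → EuclideanSpace ℝ (Fin 3)) (p : ℝ → EuclideanSpace ℝ (Fin 3) → ℝ),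
        IsMaximalSmoothSolution ν 0 u p T → HasRapidSpatialDecay (u 0) → D ν T u p) := fun h =>
  hD (h ν 1 hν one_pos _ _ ⟨drift_isClassical hg ν, drift_not_hasSmoothExtensionPast hlim ν⟩
    (drift_rapidDecay h0))

/-- **Template (a-priori form).**  A clause over classical solutions on `[0, T) × ℝ³` from rapidly
decaying data, with the Leray–Hopf hypothesis deleted, is false as soon as its conclusion fails on one
parasitic drift with `g` smooth on `(-∞, 1)` and `g(0) = 0` (no blow-up required), at any viscosity.
[cite: KochNadirashviliSereginSverak2009, §1 p. 3 (parasitic solutions)] -/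
theorem aprioriClause_false_without_lerayHopf_of_drift {g : ℝ → ℝ} (hg : ContDiffOn ℝ ∞ g (Iio 1))
    (h0 : g 0 = 0) {ν : ℝ} (hν : 0 < ν) (hD : ¬ D ν 1 (drift g) (driftP g)) :
    ¬ (∀ (ν T : ℝ), 0 < ν → 0 < T → ∀ (u : ℝ → EuclideanSpace ℝ (Fin 3) → EuclideanSpace ℝ (Fin 3)) (p : ℝ → EuclideanSpace ℝ (Fin 3) → ℝ),
        IsClassicalNSSolutionOn (Ico 0 T) ν 0 u p → HasRapidSpatialDecay (u 0) → D ν T u p) := fun h =>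
  hD (h ν 1 hν one_pos _ _ (drift_isClassical hg ν) (drift_rapidDecay h0))

/-! ## Instances -/

/-- The linear drift `g(t) = t`: `‖u(t, x)‖ = |t|`. [folklore] -/
theorem norm_drift_id (t : ℝ) (x : EuclideanSpace ℝ (Fin 3)) : ‖drift (fun s : ℝ => s) t x‖ = |t| := norm_drift _ t x

/-- **Without the energy class the datum does not determine the solution.**  The clause «a classical
solution on `[0, T) × ℝ³` with datum `0` vanishes identically» — the weakest conceivable a-priori bound in
terms of the datum — is FALSE once `IsLerayHopfOn` is deleted: the drift `u(t, x) = t·e₁`, `p = −x₁` is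
classical on `[0, 1) × ℝ³` from the (rapidly decaying) datum `0` and `‖u(½, x)‖ = ½ ≠ 0`.  Every
«controlling quantity» estimate `Φ(u(t)) ≤ F(datum)` therefore consumes the energy class.
[cite: KochNadirashviliSereginSverak2009, §1 p. 3 (parasitic solutions)] -/
theorem zeroDatumStaysZero_false_without_lerayHopf :
    ¬ (∀ (ν T : ℝ), 0 < ν → 0 < T → ∀ (u : ℝ → EuclideanSpace ℝ (Fin 3) → EuclideanSpace ℝ (Fin 3)) (p : ℝ → EuclideanSpace ℝ (Fin 3) → ℝ),
        IsClassicalNSSolutionOn (Ico 0 T) ν 0 u p → HasRapidSpatialDecay (u 0) → u 0 = 0 →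
        ∀ t ∈ Ico 0 T, u t = 0) := by
  intro h
  have hcl : IsClassicalNSSolutionOn (Ico 0 1) 1 0 (drift (fun s : ℝ => s)) (driftP (fun s : ℝ => s)) :=
    drift_isClassical contDiffOn_id 1
  have hzero : drift (fun s : ℝ => s) 0 = 0 := drift_zero rfl
  have h1 := h 1 1 one_pos one_pos _ _ hcl (drift_rapidDecay rfl) hzero (1 / 2) ⟨by norm_num, by norm_num⟩
  have h2 : ‖drift (fun s : ℝ => s) (1 / 2) 0‖ = |(1 / 2 : ℝ)| := norm_drift_id _ _
  rw [h1] at h2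
  norm_num at h2

/-- The spatial derivative of every drift slice vanishes identically. [folklore] -/
theorem fderiv_drift_eq_zero (g : ℝ → ℝ) (t : ℝ) (x : EuclideanSpace ℝ (Fin 3)) : fderiv ℝ (drift g t) x = 0 := by
  rw [drift_apply]
  exact fderiv_const_apply _

/-- **Without the energy class, blow-up does not force gradient growth.**  The clause «a maximal classical
solution from a rapidly decaying datum has unbounded velocity gradient before its maximal time» (the
Beale–Kato–Majda-type necessary condition every `∇u`/`ω`/strain-controlled criterion presupposes) is FALSE
once `IsLerayHopfOn` is deleted: the Type-II drift `g(t) = (1 − t)⁻¹ − 1` is maximal with lifespan `1`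
from the datum `0` (`drift_gII_isMaximalSmoothSolution`) and `fderiv ℝ (u t) x = 0` for all `t, x`.
[cite: KochNadirashviliSereginSverak2009, §1 p. 3 (parasitic solutions)] -/
theorem gradientBlowupClause_false_without_lerayHopf :
    ¬ (∀ (ν T : ℝ), 0 < ν → 0 < T → ∀ (u : ℝ → EuclideanSpace ℝ (Fin 3) → EuclideanSpace ℝ (Fin 3)) (p : ℝ → EuclideanSpace ℝ (Fin 3) → ℝ),
        IsMaximalSmoothSolution ν 0 u p T → HasRapidSpatialDecay (u 0) →
        ∀ M : ℝ, ∃ t ∈ Ico 0 T, ∃ x : EuclideanSpace ℝ (Fin 3), M < ‖fderiv ℝ (u t) x‖) := by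
  refine blowupClause_false_without_lerayHopf_of_drift
    (D := fun _ T u _ => ∀ M : ℝ, ∃ t ∈ Ico 0 T, ∃ x : EuclideanSpace ℝ (Fin 3), M < ‖fderiv ℝ (u t) x‖)
    gII_contDiffOn gII_zero tendsto_abs_gII_atTop one_pos ?_
  intro hD
  obtain ⟨t, -, x, hx⟩ := hD 0
  rw [fderiv_drift_eq_zero, norm_zero] at hx
  exact lt_irrefl 0 hx

end Summit.NavierStokesRegularity.NavierStokesRegularity.Theorems.TypeIliouvilleNoTypeIINegative

end
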